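import Mathlib
import Summits.Ventures.PercRepro2.HCov
import Summits.Ventures.PercRepro2.HCovSwap
import Summits.Ventures.PercRepro2.J1CoincTable

/-!
# The cross term (J1) at the coincidences `b = o` and `b = a₃` — two theorems by exact certificates
(blind cell PercRepro2, mine-a g10 — MINE-A.md §53.9; kit j229416)

With the nine cell masses `m0 … m8` of the marks `(o, a₃)` under `Q` and the certificates
`covJo_core` / `covJ3_core` of `J1CoincTable.lean`, the eight BHK instances below (`bhk_same_cluster_events`
= BHK06 Thm 1.2 under `Q`; `bhk_cross_cluster_avoid` = Thm 1.4 with the avoided sets `{a₂, a₃}`, `{a₂}` and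
their mirrors) give **`J1_coinc_o`**: `Cov_μ(σ_o, H) ≥ 0` and **`J1_coinc_a3`**: `Cov_μ(σ₃, H) ≥ 0`
(cleared by `P(Q)² · D`), `H = σ₃ (γ − 1[o ∈ U, o ↮ a₃])`, `γ = P(o ∈ U | a₃ ∉ U, Q)` — the lead's cross
term (row 2′J1) with `b := o` resp. `b := a₃`.  Since a pendant `b` at `y` has `σ_b = 1[f open] · σ_y`,
these are (J1) at every pendant `b` attached to `o` or to `a₃`.
-/

namespace Summit.Ventures.PercRepro2

open UnionCluster

namespace J1Coinc

section Instances

variable {V : Type*} {E : Type*} [Fintype E] [DecidableEq E] [Fintype V] [DecidableEq V]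
  {R : Type*} [Field R] [LinearOrder R] [IsStrictOrderedRing R]

variable (p : E → R) (ends : E → Sym2 V) (o a₁ a₂ a₃ : V)

local notation3 "Q" => avoidAll ends a₂ {a₁}
local notation3 "oL" => connEvent ends a₁ o
local notation3 "oH" => connEvent ends a₂ o
local notation3 "oN" => (connEvent ends a₁ o)ᶜ ∩ (connEvent ends a₂ o)ᶜ
local notation3 "tL" => connEvent ends a₁ a₃
local notation3 "tH" => connEvent ends a₂ a₃
local notation3 "tN" => (connEvent ends a₁ a₃)ᶜ ∩ (connEvent ends a₂ a₃)ᶜ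

/-! ### The BHK instances on the cells -/

/-- BHK 1.2 under `Q`, root `a₁`, events `{o ∈ C₁}`, `{a₃ ∈ C₁}` (`same[L;o,3;X=t,Y=t]`). -/
lemma inst_sameL (hp : IsProbVec p) :
    0 ≤ prob p (Q ∩ oL ∩ tL) * prob p (Q ∩ oH ∩ tH) + prob p (Q ∩ oL ∩ tL) * prob p (Q ∩ oH ∩ tN) +
      prob p (Q ∩ oL ∩ tL) * prob p (Q ∩ oN ∩ tH) + prob p (Q ∩ oL ∩ tL) * prob p (Q ∩ oN ∩ tN) -
      prob p (Q ∩ oL ∩ tH) * prob p (Q ∩ oH ∩ tL) - prob p (Q ∩ oL ∩ tH) * prob p (Q ∩ oN ∩ tL) -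
      prob p (Q ∩ oL ∩ tN) * prob p (Q ∩ oH ∩ tL) - prob p (Q ∩ oL ∩ tN) * prob p (Q ∩ oN ∩ tL) := by
  have h := bhk_same_cluster_events p hp ends a₁ a₂ (isUpperSet_mem_setOf o) (isUpperSet_mem_setOf a₃)
  rw [← connEvent_eq_clusterInEvent ends a₁ o, ← connEvent_eq_clusterInEvent ends a₁ a₃,
    Qc_eq ends a₁ a₂] at h
  have e1 : oL ∩ Q = Q ∩ oL := Set.inter_comm _ _
  have e2 : tL ∩ Q = Q ∩ tL := Set.inter_comm _ _
  have e3 : oL ∩ tL ∩ Q = Q ∩ oL ∩ tL := by ext ω; simp only [Set.mem_inter_iff]; tauto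
  rw [e1, e2, e3, split3 p ends a₁ a₂ a₃ oL, splitO p ends o a₁ a₂ tL, hZ p ends o a₁ a₂ a₃] at h
  linarith [h]

/-- BHK 1.2 under `Q`, root `a₂` (`same[H;o,3;X=t,Y=t]`). -/
lemma inst_sameH (hp : IsProbVec p) :
    0 ≤ prob p (Q ∩ oL ∩ tL) * prob p (Q ∩ oH ∩ tH) - prob p (Q ∩ oL ∩ tH) * prob p (Q ∩ oH ∩ tL) -
      prob p (Q ∩ oL ∩ tH) * prob p (Q ∩ oH ∩ tN) + prob p (Q ∩ oL ∩ tN) * prob p (Q ∩ oH ∩ tH) -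
      prob p (Q ∩ oH ∩ tL) * prob p (Q ∩ oN ∩ tH) + prob p (Q ∩ oH ∩ tH) * prob p (Q ∩ oN ∩ tL) +
      prob p (Q ∩ oH ∩ tH) * prob p (Q ∩ oN ∩ tN) - prob p (Q ∩ oH ∩ tN) * prob p (Q ∩ oN ∩ tH) := by
  have h := bhk_same_cluster_events p hp ends a₂ a₁ (isUpperSet_mem_setOf o) (isUpperSet_mem_setOf a₃)
  rw [← connEvent_eq_clusterInEvent ends a₂ o, ← connEvent_eq_clusterInEvent ends a₂ a₃,
    Qc'_eq ends a₁ a₂] at h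
  have e1 : oH ∩ Q = Q ∩ oH := Set.inter_comm _ _
  have e2 : tH ∩ Q = Q ∩ tH := Set.inter_comm _ _
  have e3 : oH ∩ tH ∩ Q = Q ∩ oH ∩ tH := by ext ω; simp only [Set.mem_inter_iff]; tauto
  rw [e1, e2, e3, split3 p ends a₁ a₂ a₃ oH, splitO p ends o a₁ a₂ tH, hZ p ends o a₁ a₂ a₃] at h
  linarith [h]

/-- BHK 1.4 with the avoided set `{a₂, a₃}`, root `a₁`, up-sets `{o ∈ ·}` (for `C₁`) and
`{a₃ ∈ ·} ∪ {o ∈ ·}` (for `C₂`) (`cross[L;U=o,V=3|o;X=3]`). -/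
lemma inst_crossL_3o (hp : IsProbVec p) :
    0 ≤ -(prob p (Q ∩ oL ∩ tH) * prob p (Q ∩ oN ∩ tN)) + prob p (Q ∩ oL ∩ tN) * prob p (Q ∩ oH ∩ tH) +
      prob p (Q ∩ oL ∩ tN) * prob p (Q ∩ oH ∩ tN) + prob p (Q ∩ oL ∩ tN) * prob p (Q ∩ oN ∩ tH) := by
  have h := bhk_cross_cluster_avoid p hp ends a₁ a₂ (X := {a₂, a₃}) (Finset.mem_insert_self a₂ {a₃})
    (isUpperSet_mem_setOf o) ((isUpperSet_mem_setOf a₃).union (isUpperSet_mem_setOf o))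
  rw [← connEvent_eq_clusterInEvent ends a₁ o, cI_union ends a₂ a₃ o, R_eq ends a₁ a₂ a₃] at h
  have e1 : oL ∩ (tH ∪ oH) ∩ (Q ∩ tLᶜ) = Q ∩ oL ∩ tH := by
    ext ω
    simp only [Set.mem_inter_iff, Set.mem_union, Set.mem_compl_iff, mem_connEvent]
    constructor
    · rintro ⟨⟨hoL, hH | hoH⟩, hQ, _⟩
      · exact ⟨⟨hQ, hoL⟩, hH⟩
      · exact (not_both ends a₁ a₂ hQ hoL hoH).elim
    · rintro ⟨⟨hQ, hoL⟩, hH⟩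
      exact ⟨⟨hoL, Or.inl hH⟩, hQ, fun hL => not_both ends a₁ a₂ hQ hL hH⟩
  have e2 : oL ∩ (Q ∩ tLᶜ) = Q ∩ oL ∩ tLᶜ := by ext ω; simp only [Set.mem_inter_iff]; tauto
  rw [e1, e2, hU1 p ends o a₁ a₂ a₃, hR p ends a₁ a₂ a₃, hoLtLc p ends o a₁ a₂ a₃] at h
  rw [hZ p ends o a₁ a₂ a₃, splitO p ends o a₁ a₂ tL, splitO p ends o a₁ a₂ tH,
    split3 p ends a₁ a₂ a₃ oL] at h
  linarith [h]

/-- BHK 1.4 with the avoided set `{a₂, a₃}`, root `a₁`, up-sets `{o ∈ ·}`, `{a₃ ∈ ·}` (`cross[L;U=o,V=3;X=3]`). -/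
lemma inst_crossL_3 (hp : IsProbVec p) :
    0 ≤ -(prob p (Q ∩ oL ∩ tH) * prob p (Q ∩ oH ∩ tN)) - prob p (Q ∩ oL ∩ tH) * prob p (Q ∩ oN ∩ tN) +
      prob p (Q ∩ oL ∩ tN) * prob p (Q ∩ oH ∩ tH) + prob p (Q ∩ oL ∩ tN) * prob p (Q ∩ oN ∩ tH) := by
  have h := bhk_cross_cluster_avoid p hp ends a₁ a₂ (X := {a₂, a₃}) (Finset.mem_insert_self a₂ {a₃})
    (isUpperSet_mem_setOf o) (isUpperSet_mem_setOf a₃)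
  rw [← connEvent_eq_clusterInEvent ends a₁ o, ← connEvent_eq_clusterInEvent ends a₂ a₃,
    R_eq ends a₁ a₂ a₃] at h
  have e1 : oL ∩ tH ∩ (Q ∩ tLᶜ) = Q ∩ oL ∩ tH := by
    ext ω
    simp only [Set.mem_inter_iff, Set.mem_compl_iff, mem_connEvent]
    constructor
    · rintro ⟨⟨hoL, hH⟩, hQ, _⟩; exact ⟨⟨hQ, hoL⟩, hH⟩
    · rintro ⟨⟨hQ, hoL⟩, hH⟩; exact ⟨⟨hoL, hH⟩, hQ, fun hL => not_both ends a₁ a₂ hQ hL hH⟩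
  have e2 : oL ∩ (Q ∩ tLᶜ) = Q ∩ oL ∩ tLᶜ := by ext ω; simp only [Set.mem_inter_iff]; tauto
  have e3 : tH ∩ (Q ∩ tLᶜ) = Q ∩ tH := by
    ext ω
    simp only [Set.mem_inter_iff, Set.mem_compl_iff, mem_connEvent]
    constructor
    · rintro ⟨hH, hQ, _⟩; exact ⟨hQ, hH⟩
    · rintro ⟨hQ, hH⟩; exact ⟨hH, hQ, fun hL => not_both ends a₁ a₂ hQ hL hH⟩
  rw [e1, e2, e3, hR p ends a₁ a₂ a₃, hoLtLc p ends o a₁ a₂ a₃] at h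
  rw [hZ p ends o a₁ a₂ a₃, splitO p ends o a₁ a₂ tL, splitO p ends o a₁ a₂ tH,
    split3 p ends a₁ a₂ a₃ oL] at h
  linarith [h]

/-- BHK 1.4 with the avoided set `{a₂}`, root `a₁`, up-sets `{a₃ ∈ ·}` (for `C₁`) and `{a₃ ∈ ·} ∪ {o ∈ ·}`
(for `C₂`) (`cross[L;U=3,V=3|o;X=t]`). -/
lemma inst_crossL_3_3o (hp : IsProbVec p) :
    0 ≤ prob p (Q ∩ oL ∩ tL) * prob p (Q ∩ oL ∩ tH) + prob p (Q ∩ oL ∩ tL) * prob p (Q ∩ oH ∩ tH) +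
      prob p (Q ∩ oL ∩ tL) * prob p (Q ∩ oH ∩ tN) + prob p (Q ∩ oL ∩ tL) * prob p (Q ∩ oN ∩ tH) +
      prob p (Q ∩ oL ∩ tH) * prob p (Q ∩ oN ∩ tL) - prob p (Q ∩ oL ∩ tN) * prob p (Q ∩ oH ∩ tL) -
      prob p (Q ∩ oH ∩ tL) * prob p (Q ∩ oN ∩ tN) + prob p (Q ∩ oH ∩ tH) * prob p (Q ∩ oN ∩ tL) +
      prob p (Q ∩ oH ∩ tN) * prob p (Q ∩ oN ∩ tL) + prob p (Q ∩ oN ∩ tL) * prob p (Q ∩ oN ∩ tH) := by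
  have h := bhk_cross_cluster_avoid p hp ends a₁ a₂ (X := {a₂}) (Finset.mem_singleton_self a₂)
    (isUpperSet_mem_setOf a₃) ((isUpperSet_mem_setOf a₃).union (isUpperSet_mem_setOf o))
  rw [← connEvent_eq_clusterInEvent ends a₁ a₃, cI_union ends a₂ a₃ o, CovForm.avoidAll_root_swap] at h
  have e1 : tL ∩ (tH ∪ oH) ∩ Q = Q ∩ oH ∩ tL := by
    ext ω
    simp only [Set.mem_inter_iff, Set.mem_union, mem_connEvent]
    constructor
    · rintro ⟨⟨hL, hH | hoH⟩, hQ⟩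
      · exact (not_both ends a₁ a₂ hQ hL hH).elim
      · exact ⟨⟨hQ, hoH⟩, hL⟩
    · rintro ⟨⟨hQ, hoH⟩, hL⟩; exact ⟨⟨hL, Or.inr hoH⟩, hQ⟩
  have e2 : tL ∩ Q = Q ∩ tL := Set.inter_comm _ _
  rw [e1, e2, hU3 p ends o a₁ a₂ a₃, hoHtHc p ends o a₁ a₂ a₃] at h
  rw [hZ p ends o a₁ a₂ a₃, splitO p ends o a₁ a₂ tL, splitO p ends o a₁ a₂ tH,
    split3 p ends a₁ a₂ a₃ oH] at h
  linarith [h]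

/-- BHK 1.4 with the avoided set `{a₂}`, root `a₁`, up-sets `{a₃ ∈ ·} ∪ {o ∈ ·}` (for `C₁`) and `{a₃ ∈ ·}`
(for `C₂`) (`cross[L;U=3|o,V=3;X=t]`). -/
lemma inst_crossL_3o_3 (hp : IsProbVec p) :
    0 ≤ prob p (Q ∩ oL ∩ tL) * prob p (Q ∩ oH ∩ tH) + prob p (Q ∩ oL ∩ tL) * prob p (Q ∩ oN ∩ tH) -
      prob p (Q ∩ oL ∩ tH) * prob p (Q ∩ oH ∩ tN) - prob p (Q ∩ oL ∩ tH) * prob p (Q ∩ oN ∩ tN) +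
      prob p (Q ∩ oL ∩ tN) * prob p (Q ∩ oH ∩ tH) + prob p (Q ∩ oL ∩ tN) * prob p (Q ∩ oN ∩ tH) +
      prob p (Q ∩ oH ∩ tL) * prob p (Q ∩ oH ∩ tH) + prob p (Q ∩ oH ∩ tL) * prob p (Q ∩ oN ∩ tH) +
      prob p (Q ∩ oH ∩ tH) * prob p (Q ∩ oN ∩ tL) + prob p (Q ∩ oN ∩ tL) * prob p (Q ∩ oN ∩ tH) := by
  have h := bhk_cross_cluster_avoid p hp ends a₁ a₂ (X := {a₂}) (Finset.mem_singleton_self a₂)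
    ((isUpperSet_mem_setOf a₃).union (isUpperSet_mem_setOf o)) (isUpperSet_mem_setOf a₃)
  rw [cI_union ends a₁ a₃ o, ← connEvent_eq_clusterInEvent ends a₂ a₃, CovForm.avoidAll_root_swap] at h
  have e1 : (tL ∪ oL) ∩ tH ∩ Q = Q ∩ oL ∩ tH := by
    ext ω
    simp only [Set.mem_inter_iff, Set.mem_union, mem_connEvent]
    constructor
    · rintro ⟨⟨hL | hoL, hH⟩, hQ⟩
      · exact (not_both ends a₁ a₂ hQ hL hH).elim
      · exact ⟨⟨hQ, hoL⟩, hH⟩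
    · rintro ⟨⟨hQ, hoL⟩, hH⟩; exact ⟨⟨Or.inr hoL, hH⟩, hQ⟩
  have e2 : tH ∩ Q = Q ∩ tH := Set.inter_comm _ _
  rw [e1, e2, hU4 p ends o a₁ a₂ a₃, hoLtLc p ends o a₁ a₂ a₃] at h
  rw [hZ p ends o a₁ a₂ a₃, splitO p ends o a₁ a₂ tL, splitO p ends o a₁ a₂ tH,
    split3 p ends a₁ a₂ a₃ oL] at h
  linarith [h]

/-- BHK 1.4 with the avoided set `{a₁, a₃}`, root `a₂`, up-sets `{o ∈ ·}` (for `C₂`) and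
`{a₃ ∈ ·} ∪ {o ∈ ·}` (for `C₁`) (`cross[H;U=o,V=3|o;X=3]`). -/
lemma inst_crossH_3o (hp : IsProbVec p) :
    0 ≤ prob p (Q ∩ oL ∩ tL) * prob p (Q ∩ oH ∩ tN) + prob p (Q ∩ oL ∩ tN) * prob p (Q ∩ oH ∩ tN) -
      prob p (Q ∩ oH ∩ tL) * prob p (Q ∩ oN ∩ tN) + prob p (Q ∩ oH ∩ tN) * prob p (Q ∩ oN ∩ tL) := by
  have h := bhk_cross_cluster_avoid p hp ends a₂ a₁ (X := {a₁, a₃}) (Finset.mem_insert_self a₁ {a₃})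
    (isUpperSet_mem_setOf o) ((isUpperSet_mem_setOf a₃).union (isUpperSet_mem_setOf o))
  rw [← connEvent_eq_clusterInEvent ends a₂ o, cI_union ends a₁ a₃ o, R'_eq ends a₁ a₂ a₃] at h
  have e1 : oH ∩ (tL ∪ oL) ∩ (Q ∩ tHᶜ) = Q ∩ oH ∩ tL := by
    ext ω
    simp only [Set.mem_inter_iff, Set.mem_union, Set.mem_compl_iff, mem_connEvent]
    constructor
    · rintro ⟨⟨hoH, hL | hoL⟩, hQ, _⟩
      · exact ⟨⟨hQ, hoH⟩, hL⟩
      · exact (not_both ends a₁ a₂ hQ hoL hoH).elim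
    · rintro ⟨⟨hQ, hoH⟩, hL⟩
      exact ⟨⟨hoH, Or.inl hL⟩, hQ, fun hH => not_both ends a₁ a₂ hQ hL hH⟩
  have e2 : oH ∩ (Q ∩ tHᶜ) = Q ∩ oH ∩ tHᶜ := by ext ω; simp only [Set.mem_inter_iff]; tauto
  rw [e1, e2, hU2 p ends o a₁ a₂ a₃, hR' p ends a₁ a₂ a₃, hoHtHc p ends o a₁ a₂ a₃] at h
  rw [hZ p ends o a₁ a₂ a₃, splitO p ends o a₁ a₂ tL, splitO p ends o a₁ a₂ tH,
    split3 p ends a₁ a₂ a₃ oH] at h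
  linarith [h]

/-- BHK 1.4 with the avoided set `{a₁, a₃}`, root `a₂`, up-sets `{o ∈ ·}`, `{a₃ ∈ ·}` (`cross[H;U=o,V=3;X=3]`). -/
lemma inst_crossH_3 (hp : IsProbVec p) :
    0 ≤ prob p (Q ∩ oL ∩ tL) * prob p (Q ∩ oH ∩ tN) - prob p (Q ∩ oL ∩ tN) * prob p (Q ∩ oH ∩ tL) -
      prob p (Q ∩ oH ∩ tL) * prob p (Q ∩ oN ∩ tN) + prob p (Q ∩ oH ∩ tN) * prob p (Q ∩ oN ∩ tL) := by
  have h := bhk_cross_cluster_avoid p hp ends a₂ a₁ (X := {a₁, a₃}) (Finset.mem_insert_self a₁ {a₃})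
    (isUpperSet_mem_setOf o) (isUpperSet_mem_setOf a₃)
  rw [← connEvent_eq_clusterInEvent ends a₂ o, ← connEvent_eq_clusterInEvent ends a₁ a₃,
    R'_eq ends a₁ a₂ a₃] at h
  have e1 : oH ∩ tL ∩ (Q ∩ tHᶜ) = Q ∩ oH ∩ tL := by
    ext ω
    simp only [Set.mem_inter_iff, Set.mem_compl_iff, mem_connEvent]
    constructor
    · rintro ⟨⟨hoH, hL⟩, hQ, _⟩; exact ⟨⟨hQ, hoH⟩, hL⟩
    · rintro ⟨⟨hQ, hoH⟩, hL⟩; exact ⟨⟨hoH, hL⟩, hQ, fun hH => not_both ends a₁ a₂ hQ hL hH⟩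
  have e2 : oH ∩ (Q ∩ tHᶜ) = Q ∩ oH ∩ tHᶜ := by ext ω; simp only [Set.mem_inter_iff]; tauto
  have e3 : tL ∩ (Q ∩ tHᶜ) = Q ∩ tL := by
    ext ω
    simp only [Set.mem_inter_iff, Set.mem_compl_iff, mem_connEvent]
    constructor
    · rintro ⟨hL, hQ, _⟩; exact ⟨hQ, hL⟩
    · rintro ⟨hQ, hL⟩; exact ⟨hL, hQ, fun hH => not_both ends a₁ a₂ hQ hL hH⟩
  rw [e1, e2, e3, hR' p ends a₁ a₂ a₃, hoHtHc p ends o a₁ a₂ a₃] at h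
  rw [hZ p ends o a₁ a₂ a₃, splitO p ends o a₁ a₂ tL, splitO p ends o a₁ a₂ tH,
    split3 p ends a₁ a₂ a₃ oH] at h
  linarith [h]

/-! ### The two theorems -/

/-- **(J1) at `b = o`**: `E_Q[σ_o] · E_Q[D·H] ≤ P(Q) · E_Q[σ_o · D·H]`, i.e. `Cov_μ(σ_o, H) ≥ 0` (cleared by
`P(Q)² · D`), with `D = P(PD) = m2 + m5 + m8`, `D_o = P(PD, o ∈ U) = m2 + m5`,
`E_Q[σ_o · D·H] = D_o (m0 + m4) + (D − D_o)(m1 + m3)`, `E_Q[σ_o] = (m0 + m1 + m2) − (m3 + m4 + m5)`,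
`E_Q[D·H] = D_o (m0 − m4 + m6 − m7) + (D − D_o)(m1 − m3)`. -/
theorem J1_coinc_o (hp : IsProbVec p) :
    ((prob p (Q ∩ oL ∩ tL) + prob p (Q ∩ oL ∩ tH) + prob p (Q ∩ oL ∩ tN)) -
        (prob p (Q ∩ oH ∩ tL) + prob p (Q ∩ oH ∩ tH) + prob p (Q ∩ oH ∩ tN))) *
      ((prob p (Q ∩ oL ∩ tN) + prob p (Q ∩ oH ∩ tN)) *
          (prob p (Q ∩ oL ∩ tL) - prob p (Q ∩ oH ∩ tH) + prob p (Q ∩ oN ∩ tL) - prob p (Q ∩ oN ∩ tH)) +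
        prob p (Q ∩ oN ∩ tN) * (prob p (Q ∩ oL ∩ tH) - prob p (Q ∩ oH ∩ tL))) ≤
    prob p Q *
      ((prob p (Q ∩ oL ∩ tN) + prob p (Q ∩ oH ∩ tN)) * (prob p (Q ∩ oL ∩ tL) + prob p (Q ∩ oH ∩ tH)) +
        prob p (Q ∩ oN ∩ tN) * (prob p (Q ∩ oL ∩ tH) + prob p (Q ∩ oH ∩ tL))) := by
  have core := covJo_core (prob p (Q ∩ oL ∩ tL)) (prob p (Q ∩ oL ∩ tH)) (prob p (Q ∩ oL ∩ tN))
    (prob p (Q ∩ oH ∩ tL)) (prob p (Q ∩ oH ∩ tH)) (prob p (Q ∩ oH ∩ tN)) (prob p (Q ∩ oN ∩ tL))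
    (prob p (Q ∩ oN ∩ tH)) (prob p (Q ∩ oN ∩ tN)) (prob_nonneg hp _) (prob_nonneg hp _) (prob_nonneg hp _)
    (prob_nonneg hp _) (prob_nonneg hp _) (prob_nonneg hp _) (prob_nonneg hp _) (prob_nonneg hp _)
    (prob_nonneg hp _) (inst_sameL p ends o a₁ a₂ a₃ hp) (inst_crossL_3o p ends o a₁ a₂ a₃ hp)
    (inst_sameH p ends o a₁ a₂ a₃ hp) (inst_crossH_3o p ends o a₁ a₂ a₃ hp)
  rw [hZ p ends o a₁ a₂ a₃]
  linarith [core]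

/-- **(J1) at `b = a₃`**: `E_Q[σ₃] · E_Q[D·H] ≤ P(Q) · E_Q[σ₃ · D·H]`, i.e. `Cov_μ(σ₃, H) ≥ 0` (cleared by
`P(Q)² · D`), with `E_Q[σ₃ · D·H] = D_o (m0 + m4 + m6 + m7) − (D − D_o)(m1 + m3)`,
`E_Q[σ₃] = (m0 + m3 + m6) − (m1 + m4 + m7)` and `E_Q[D·H]` as in `J1_coinc_o`. -/
theorem J1_coinc_a3 (hp : IsProbVec p) :
    ((prob p (Q ∩ oL ∩ tL) + prob p (Q ∩ oH ∩ tL) + prob p (Q ∩ oN ∩ tL)) -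
        (prob p (Q ∩ oL ∩ tH) + prob p (Q ∩ oH ∩ tH) + prob p (Q ∩ oN ∩ tH))) *
      ((prob p (Q ∩ oL ∩ tN) + prob p (Q ∩ oH ∩ tN)) *
          (prob p (Q ∩ oL ∩ tL) - prob p (Q ∩ oH ∩ tH) + prob p (Q ∩ oN ∩ tL) - prob p (Q ∩ oN ∩ tH)) +
        prob p (Q ∩ oN ∩ tN) * (prob p (Q ∩ oL ∩ tH) - prob p (Q ∩ oH ∩ tL))) ≤
    prob p Q *
      ((prob p (Q ∩ oL ∩ tN) + prob p (Q ∩ oH ∩ tN)) *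
          (prob p (Q ∩ oL ∩ tL) + prob p (Q ∩ oH ∩ tH) + prob p (Q ∩ oN ∩ tL) + prob p (Q ∩ oN ∩ tH)) -
        prob p (Q ∩ oN ∩ tN) * (prob p (Q ∩ oL ∩ tH) + prob p (Q ∩ oH ∩ tL))) := by
  have core := covJ3_core (prob p (Q ∩ oL ∩ tL)) (prob p (Q ∩ oL ∩ tH)) (prob p (Q ∩ oL ∩ tN))
    (prob p (Q ∩ oH ∩ tL)) (prob p (Q ∩ oH ∩ tH)) (prob p (Q ∩ oH ∩ tN)) (prob p (Q ∩ oN ∩ tL))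
    (prob p (Q ∩ oN ∩ tH)) (prob p (Q ∩ oN ∩ tN)) (prob_nonneg hp _) (prob_nonneg hp _) (prob_nonneg hp _)
    (prob_nonneg hp _) (prob_nonneg hp _) (prob_nonneg hp _) (prob_nonneg hp _) (prob_nonneg hp _)
    (prob_nonneg hp _) (inst_crossL_3 p ends o a₁ a₂ a₃ hp) (inst_crossL_3o p ends o a₁ a₂ a₃ hp)
    (inst_crossL_3_3o p ends o a₁ a₂ a₃ hp) (inst_crossL_3o_3 p ends o a₁ a₂ a₃ hp)
    (inst_crossH_3 p ends o a₁ a₂ a₃ hp) (inst_crossH_3o p ends o a₁ a₂ a₃ hp)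
  rw [hZ p ends o a₁ a₂ a₃]
  linarith [core]

end Instances

end J1Coinc

end Summit.Ventures.PercRepro2
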